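import Mathlib
import Summits.Ventures.HodgeRepro2.CyclotomicSevenTypes
import Summits.Ventures.HodgeRepro2.GaloisSextic

/-!
# CyclotomicSevenGalois — the `ℤ/6` model of `Gal(ℚ(ζ₇)/ℚ)` made explicit

Follow-up to `CyclotomicSevenTypes.lean`: under `galEquivUnitsZMod : Gal(K7/ℚ) ≃* (ℤ/7)^×`,

* complex conjugation (the CM involution `galConj K7`, which sends `ζ₇ ↦ ζ₇⁻¹`) corresponds to `−1 ∈ (ℤ/7)^×`
  (`galEquivUnitsZMod_galConj`);
* the automorphism `gen3 : ζ₇ ↦ ζ₇³` (the preimage of the primitive root `3 mod 7`) has order `6`, i.e. generates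
  `Gal(K7/ℚ)` (`orderOf_gen3`, `zpowers_gen3_eq_top`), and its cube is complex conjugation
  (`gen3_pow_three`): «coordinate 3 of the `ℤ/6` model is complex conjugation» (`SexticGalois.e_ofAdd_three`)
  is verified on the concrete field.

Not formalised: the explicit `ℤ/6` coordinates of the parity tetrahedra of `ℚ(ζ₇)` (they are
`Sextic.zType` for the coordinate triple determined by `gen3` — a computation left to a successor).
-/

namespace Summit.Ventures.HodgeRepro2.CyclotomicSeven

/-- `galEquivUnitsZMod σ` is the exponent `k` with `σ ζ₇ = ζ₇ ^ k` (Mathlib's `autToPow_spec`). -/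
theorem zeta7_pow_val (σ : K7 ≃ₐ[ℚ] K7) :
    zeta7 ^ ((galEquivUnitsZMod σ : ZMod 7).val) = σ zeta7 :=
  (IsCyclotomicExtension.zeta_spec 7 ℚ K7).autToPow_spec ℚ σ

/-- Complex conjugation (the CM involution of `K7`) inverts `ζ₇`. -/
theorem galConj_zeta7 : galConj K7 zeta7 = zeta7⁻¹ :=
  star_zeta7

/-- Under `Gal(K7/ℚ) ≅ (ℤ/7)^×`, complex conjugation is `−1`. -/
theorem galEquivUnitsZMod_galConj : galEquivUnitsZMod (galConj K7) = -1 := by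
  have hζ := isPrimitiveRoot_zeta7
  have h1 : zeta7 ^ ((galEquivUnitsZMod (galConj K7) : ZMod 7).val) = zeta7 ^ 6 := by
    rw [zeta7_pow_val, galConj_zeta7]
    have h6 : zeta7 ^ 6 * zeta7 = 1 := by rw [← pow_succ, hζ.pow_eq_one]
    exact (eq_inv_of_mul_eq_one_left h6).symm
  have h2 : ((galEquivUnitsZMod (galConj K7) : ZMod 7).val) = 6 :=
    hζ.pow_inj (ZMod.val_lt _) (by norm_num) h1
  apply Units.ext
  rw [← ZMod.natCast_zmod_val (galEquivUnitsZMod (galConj K7) : ZMod 7), h2]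
  decide

/-- The unit `3 mod 7` of `(ℤ/7)^×` (a primitive root mod 7). -/
def three : (ZMod 7)ˣ := ZMod.unitOfCoprime 3 (by decide)

/-- `three` is `3`. -/
@[simp] theorem coe_three : (three : ZMod 7) = 3 := ZMod.coe_unitOfCoprime 3 _

/-- The automorphism `ζ₇ ↦ ζ₇³` (the preimage of the primitive root `3 mod 7`). -/
noncomputable def gen3 : K7 ≃ₐ[ℚ] K7 := galEquivUnitsZMod.symm three

/-- `gen3 ζ₇ = ζ₇ ^ 3`. -/
theorem gen3_zeta7 : gen3 zeta7 = zeta7 ^ 3 := by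
  rw [← zeta7_pow_val, gen3, MulEquiv.apply_symm_apply, coe_three]
  rfl

/-- `3 mod 7` has order `6` in `(ℤ/7)^×`. -/
theorem orderOf_three : orderOf three = 6 := by
  rw [orderOf_eq_iff (by norm_num)]
  refine ⟨by decide, ?_⟩
  intro m hm hm0
  interval_cases m <;> decide

/-- `gen3` has order `6`: it generates `Gal(K7/ℚ)`. -/
theorem orderOf_gen3 : orderOf gen3 = 6 := by
  rw [gen3, ← orderOf_three]
  exact orderOf_injective galEquivUnitsZMod.symm.toMonoidHom galEquivUnitsZMod.symm.injective three

/-- `gen3` generates `Gal(K7/ℚ)`. -/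
theorem zpowers_gen3_eq_top : Subgroup.zpowers gen3 = ⊤ := by
  apply Subgroup.eq_top_of_card_eq
  rw [Nat.card_zpowers, orderOf_gen3, card_gal_K7]

/-- «Coordinate 3 is complex conjugation»: `gen3 ^ 3 = galConj K7` (`ζ₇ ↦ ζ₇ ^ 27 = ζ₇⁻¹`). -/
theorem gen3_pow_three : gen3 ^ 3 = galConj K7 := by
  apply galEquivUnitsZMod.injective
  rw [map_pow, galEquivUnitsZMod_galConj, gen3, MulEquiv.apply_symm_apply]
  decide

end Summit.Ventures.HodgeRepro2.CyclotomicSeven
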